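import Summits.QuantumFields.YangMills.Theorems.BalabanUVNodesN15TwoGridDressedJetNoFitC
import Summits.QuantumFields.YangMills.Theorems.BalabanUVNodesN15KingModelGradCellOscillation
import Summits.QuantumFields.YangMills.Theorems.BalabanUVNodesN15KingModelFullPropagatorByPartsNE2
import HarnessLib

/-!
# N15 (NE2) — PROGRAMME K «THE (3.36)-FREE FIRST-ORDER JET KNIT ON THE KING RUNG», part K-A: THE KING RUNG's `U ≡ 1` LETTERS `⊗ 1` READ IN III-B's CURRENCY
# (King's 1-form pairing carrier `Tor (fine n M) × Fin (d+1)`, coarse King blocks `blkFine`, fine unit blocks `blockOf′ ∘ fst`, pairing `kingPrV`, geometry `unitTorusGeo`)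

WHO ∕ WHEN.  Cell `pub-ymgap`, seat `pub-ymgap-dag-n15-a` (KNIT-BY-NAME seat of Track-A DAG node N15 = NE2, g25); `--kind proof --supports stmt-QuantumFields-27366 --as helper` (K3⁸;
count-neutral).  THEOREMS ONLY (0 `def`).  Trigger: dag-n15-d g20 «KNIT (go)» (INBOX l.42374) after their (S1′) producer ★ `CellOsc.hasMaj_kingDOp_comp_idef_mulOp_blockAvg` (p660796).
Inputs BY NAME (nothing in the tree is modified): dag-n15-e Σ-a `…KingModelFullPropagatorBgLetters` (`kingGOp`∕`kingDOp`∕`kingSOp`∕`kingLapOp`, `hasMaj_kingGOp`, `hasMaj_kingDOp`, `hasMaj_idef_kingGOp`,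
`hasMaj_idef_kingDOp`, `hasMaj_idef_kingSOp`, `hasMaj_idef_kingLapOp`), Σ-d `…KingModelFullPropagatorByPartsNE2` (`hasMaj_kingDOp_coarse`, `hasMaj_kingSOp_fine`), Σ-c∕ByPartsLetters (`underPtN_eq_kingPr`), F₀ (`blockOf_underPtN`), dag-n15-c M4
`…VectorPieceBackgroundMatrix` (`tensorId`, `hasMaj_tensorId`, `idef_tensorId`), this seat's M-C `…TwoGridCellMean` (★★★ `hasMaj_comp_idef_mulOp_blockAvg_of_divAdj`) and parts 34∕35 (`symbOp`, `sD`,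
`sTinv`, `symbOp_sD_apply`, `symbOp_sTinv_apply`), dag-n15-d (S1′) `…KingModelGradCellOscillation` (★ `hasMaj_kingDOp_comp_idef_mulOp_blockAvg`).

WHY.  III-B ★★★ `hasMaj_idef_bgPair_of_sandwichRows` (the η-defect of the WHOLE first-order dressed jet — value AND gradient components — with the `c′`-defect SANDWICHED as two rows and NO
letter on `∇c′`) is stated on King's 1-form torus carriers with the difference symbols `symbOp (sD μ n)`; the King-model rung's letters (dag-n15-e Σ-a∕Σ-d) live on the SCALAR carrier
`Tor (fine N M)` with King's own `kingDOp`∕`kingSOp`, pairing `underPtN`, blocks `blockOf`, sized geometry `unitTorusGeoS`.  This file is the dictionary + the re-reading: every letter III-B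
displays, for `G := A₀⁻¹ ⊗ 1` (King's FULL `A = 0` fluctuation propagator with all levels summed, tensored with `1` on the direction index), as a LANDED theorem read through `⊗ 1`.

WHAT.  §0 dictionary: `symbOp_sD_comp_tensorId_kingGOp` (`ρ(n(s_μ − 1))∘(A₀⁻¹ ⊗ 1) = (N∇_μA₀⁻¹) ⊗ 1`), `tensorId_kingGOp_comp_symbOp_divAdj` (`(A₀⁻¹ ⊗ 1)∘ρ(n(s_κ⁻¹ − 1)) = (A₀⁻¹N∇*_κ) ⊗ 1`),
`idef_kingPrV_tensorId` (`𝔇` through `kingPrV` of two lifts = the lift of `𝔇` through `kingPr`), `blockOf_comp_underPtN`.  §1 the letters, each `∃ (consts) > 0, ∀ K ≥ 1, (n ≥ 1,) e, M = 2L^e,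
0 < m² ≤ m₀², …`: `hasMaj_tensorId_kingGOp_coarse` (hG), `hasMaj_sD_tensorId_kingGOp_coarse` (hGD), `hasMaj_tensorId_kingGOp_fine` (hG′), `hasMaj_sD_tensorId_kingGOp_fine` (hG′D),
`hasMaj_idef_tensorId_kingGOp` (hDG, rate `(L^K)^{−γ∕2}`), `hasMaj_idef_sD_tensorId_kingGOp` (hDD), `hasMaj_tensorId_kingGOp_comp_idef_mulOp_blockAvg` (hGc = M-C at `T′ := A₀′⁻¹ ⊗ 1`:
`≤ β·r·(L^K)⁻¹·e^{−δd}`, NO fit letter), and the two U-BLIND entries of the by-name packaging `hasMaj_idef_tensorId_kingSOp` ∕ `hasMaj_idef_tensorId_kingLapOp`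
(Σ-a `hasMaj_idef_kingSOp` ∕ `hasMaj_idef_kingLapOp` ⊗ 1).  §2 `hasMaj_weaken`, `hasMaj_weaken₂`, ★ `kingJet_uniform_letters`: ALL NINE ROWS III-B consumes (the seven above + dag-n15-d's cell-oscillation row
`≤ β·r·((K+2)∕L^K)·e^{−δd}`) at ONE `(δ, β)`, for every `K ≥ 1`, `n ≥ 1`, cube `2L^e`, mass `0 < m² ≤ m₀²`, `γ ∈ [0, 1)`, `d ≥ 1`.

HONEST FRAMING ∕ LIMITS.  Count-neutral KNIT plumbing over LANDED letters; King's `A = 0` MODEL on finite tori (template literature [King1986] (2.13)–(2.17) p.653, (4.1)–(4.5) p.670), NOT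
Bałaban's covariant `G(U)` (for the pair of record `(Δ′_a⁻¹, Δ_a⁻¹)` the level∕profile rows behind the ninth letter are NOT in the tree — located (S3)); [Balaban1985BackgroundPropagators] (3.42)
p.397 ∕ (3.62)–(3.65) pp.402–403 cited as SHAPE ∕ MECHANISM only.  NE2⁺ NOT printed ∕ NOT proved; no statement of record touched; N15 NOT discharged; K3⁸ OPEN; counts UNMOVED (typed 28∕28 ·
discharged 5∕27); one finite torus per index — NOT ℝ⁴ ∕ infinite volume ∕ OS ∕ mass gap ∕ Clay.
-/

noncomputable section

open scoped BigOperators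
open Finset

namespace Summit.QuantumFields.YangMills.BalabanUVNodes.N15.TwoGrid.KingJet

open Literature.MathematicalPhysics.QuantumFieldTheory.Balaban1983to89
open Literature.MathematicalPhysics.QuantumFieldTheory.Balaban1983to89.B11SectG (BlockNorm HasMaj)
open Literature.MathematicalPhysics.QuantumFieldTheory.Balaban1983to89.T4EtaRateDefect (idef idef_apply)
open Literature.MathematicalPhysics.QuantumFieldTheory.Balaban1983to89.T4EtaRateCoeffDefect (pull pull_apply blockAvg)
open Literature.MathematicalPhysics.QuantumFieldTheory.Balaban1983to89.B6Prop26Gluing (mulOp mulOp_apply)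
open Literature.MathematicalPhysics.QuantumFieldTheory.Balaban1983to89.B5Prop11Plancherel (Tor fine unitVec)
open Literature.MathematicalPhysics.QuantumFieldTheory.King1986.Torus (blockOf tdistT tdistT_nonneg)
open Literature.MathematicalPhysics.QuantumFieldTheory.Balaban1983to89.B6UnitTorusCarrier (unitTorusGeo)
open Summit.QuantumFields.YangMills.BalabanUVNodes.N15.VectorPiece (kingPr kingPrV kingPrV_eq blkFine tensorId tensorId_apply hasMaj_tensorId idef_tensorId unitTorusGeoS)
open Summit.QuantumFields.YangMills.BalabanUVNodes.N15.MatrixSpecies (liftMap liftBlk)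
open Summit.QuantumFields.YangMills.BalabanUVNodes.N15KingModelRung.Curved (kingGOp kingDOp kingSOp kingLapOp kingGOp_apply kingDOp_apply kingSOp_apply underPtN underPtN_eq_kingPr
  blockOf_underPtN hasMaj_kingGOp hasMaj_kingDOp hasMaj_kingDOp_coarse hasMaj_kingSOp_fine hasMaj_idef_kingGOp hasMaj_idef_kingDOp hasMaj_idef_kingSOp hasMaj_idef_kingLapOp)
open Summit.QuantumFields.YangMills.BalabanUVNodes.N15.KingModel.CellOsc (hasMaj_kingDOp_comp_idef_mulOp_blockAvg)

variable {d : ℕ} (L : ℕ) [NeZero L]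

/-! ## §0 Dictionary: King's scalar operators `⊗ 1` against the 1-form symbols and King's 1-form pairing -/

section Dictionary

variable (M : Fin (d + 1) → ℕ) [∀ μ, NeZero (M μ)]

omit [NeZero L] in
/-- `ρ(N(s_μ − 1)) ∘ (A₀⁻¹ ⊗ 1) = (N∇_μA₀⁻¹) ⊗ 1`: the 1-form forward-difference symbol acting on the lift of King's scalar propagator IS the lift of the rung's `kingDOp`. [folklore]
[cite: Balaban1985BackgroundPropagators, (3.42) p.397 (second entry: shape); King1986, (4.1)–(4.5) p.670] -/
theorem symbOp_sD_comp_tensorId_kingGOp (a msq : ℝ) (K N : ℕ) [NeZero N] (μ : Fin (d + 1)) :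
    symbOp M N (sD M N μ ((N : ℕ) : ℝ)) ∘ₗ tensorId (Fin (d + 1)) (kingGOp L a msq K N M) = tensorId (Fin (d + 1)) (kingDOp L a msq K N M μ) := by
  refine LinearMap.ext fun f => funext fun p => ?_
  rw [LinearMap.comp_apply, symbOp_sD_apply, tensorId_apply, tensorId_apply, tensorId_apply, kingDOp_apply, kingGOp_apply, kingGOp_apply]

omit [NeZero L] in
/-- `(A₀⁻¹ ⊗ 1) ∘ ρ(N(s_κ⁻¹ − 1)) = (A₀⁻¹N∇*_κ) ⊗ 1`: the lift of King's scalar propagator followed by the 1-form adjoint-difference symbol IS the lift of the rung's `kingSOp`.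
[folklore] [cite: Balaban1985BackgroundPropagators, (3.42) p.397 (third entry: shape); King1986, (4.1)–(4.5) p.670] -/
theorem tensorId_kingGOp_comp_symbOp_divAdj (a msq : ℝ) (K N : ℕ) [NeZero N] (κ : Fin (d + 1)) :
    tensorId (Fin (d + 1)) (kingGOp L a msq K N M) ∘ₗ symbOp M N (((N : ℕ) : ℝ) • (sTinv M N κ - 1)) = tensorId (Fin (d + 1)) (kingSOp L a msq K N M κ) := by
  refine LinearMap.ext fun f => funext fun p => ?_
  have hg : (fun x => symbOp M N (((N : ℕ) : ℝ) • (sTinv M N κ - 1)) f (x, p.2)) = fun y => ((N : ℕ) : ℝ) * (f (y - unitVec (fine N M) κ, p.2) - f (y, p.2)) := by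
    funext y
    rw [map_smul, map_sub, map_one, LinearMap.smul_apply, LinearMap.sub_apply, Pi.smul_apply, Pi.sub_apply, smul_eq_mul, symbOp_sTinv_apply]
    rfl
  rw [LinearMap.comp_apply, tensorId_apply, tensorId_apply, kingSOp_apply, kingGOp_apply, hg]

omit [NeZero L] [∀ μ, NeZero (M μ)] in
/-- `𝔇` THROUGH KING's 1-FORM PAIRING OF TWO LIFTS IS THE LIFT OF `𝔇` THROUGH THE SCALAR PAIRING: `𝔇_{kingPrV}(A′ ⊗ 1, A ⊗ 1) = 𝔇_{kingPr}(A′, A) ⊗ 1` (`kingPrV = liftMap kingPr`).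
[folklore] [cite: King1986, p.664 (pairing convention)] -/
theorem idef_kingPrV_tensorId (k m : ℕ) (A' : (Tor (fine (L ^ m * L ^ k) M) → ℝ) →ₗ[ℝ] (Tor (fine (L ^ m * L ^ k) M) → ℝ))
    (A : (Tor (fine (L ^ k) M) → ℝ) →ₗ[ℝ] (Tor (fine (L ^ k) M) → ℝ)) :
    idef (pull (kingPrV L k m M)) (pull (kingPrV L k m M)) (tensorId (Fin (d + 1)) A') (tensorId (Fin (d + 1)) A) =
      tensorId (Fin (d + 1)) (idef (pull (kingPr L k m M)) (pull (kingPr L k m M)) A' A) :=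
  LinearMap.ext fun _ => funext fun _ => rfl

/-- The rung's fine unit blocks through the pairing ARE the fine unit blocks: `blockOf (L^K) ∘ underPtN = blockOf (L^nL^K)` as functions. [cite: King1986, p.664 (pairing convention)] -/
theorem blockOf_comp_underPtN (K n : ℕ) : blockOf (L ^ K) M ∘ underPtN L K n M = blockOf (L ^ n * L ^ K) M :=
  funext fun x' => blockOf_underPtN L K n M x'

end Dictionary

/-! ## §1 The letters III-B displays, for King's full `A = 0` propagator `⊗ 1` -/

section Letters

/-- **hG — PLAIN LETTER, COARSE**: `A₀⁻¹ ⊗ 1 ≤ β·e^{−δ|y−y′|_T}` between King's coarse blocks `blkFine` (Σ-a `hasMaj_kingGOp` ⊗ 1).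
[cite: Balaban1985BackgroundPropagators, Thm 3.1 (3.42) p.397 (first entry); King1986, Thm 3.3 (3.7) p.656] -/
theorem hasMaj_tensorId_kingGOp_coarse (hLodd : Odd L) (hL : 2 ≤ L) {a : ℝ} (ha : 0 < a) {m0sq : ℝ} (hm0 : 0 ≤ m0sq) :
    ∃ β δ : ℝ, 0 < β ∧ 0 < δ ∧ ∀ (K : ℕ), 1 ≤ K → ∀ (e : ℕ) (M : Fin (d + 1) → ℕ) [∀ μ, NeZero (M μ)], (∀ μ, M μ = 2 * L ^ e) →
      ∀ (msq : ℝ), 0 < msq → msq ≤ m0sq →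
      HasMaj (BlockNorm.ofBlocks (unitTorusGeo L K M) (blkFine L K M)) (BlockNorm.ofBlocks (unitTorusGeo L K M) (blkFine L K M))
        (tensorId (Fin (d + 1)) (kingGOp L a msq K (L ^ K) M)) (fun y y' => β * Real.exp (-(δ * tdistT M y y'))) := by
  obtain ⟨β, δ, hβ, hδ, H⟩ := hasMaj_kingGOp (d := d) L hLodd hL ha hm0
  refine ⟨β, δ, hβ, hδ, fun K hK e M _ hM msq hmsq hcap => ?_⟩
  exact hasMaj_tensorId (Fin (d + 1)) (fun y y' => mul_nonneg hβ.le (Real.exp_nonneg _)) (H K hK 0 e M hM msq hmsq hcap 1).1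

/-- **hGD — DERIVED PLAIN LETTER, COARSE**: `ρ(N(s_μ − 1))∘(A₀⁻¹ ⊗ 1) ≤ β·e^{−δ|y−y′|_T}` (Σ-d `hasMaj_kingDOp_coarse` ⊗ 1, §0 dictionary).
[cite: Balaban1985BackgroundPropagators, Thm 3.1 (3.42) p.397 (second entry); Balaban1983RegularityDecay, Theorem (1.10) p.573] -/
theorem hasMaj_sD_tensorId_kingGOp_coarse (hLodd : Odd L) (hL : 2 ≤ L) {a : ℝ} (ha : 0 < a) {m0sq : ℝ} (hm0 : 0 ≤ m0sq) :
    ∃ β δ : ℝ, 0 < β ∧ 0 < δ ∧ ∀ (K : ℕ), 1 ≤ K → ∀ (e : ℕ) (M : Fin (d + 1) → ℕ) [∀ μ, NeZero (M μ)], (∀ μ, M μ = 2 * L ^ e) →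
      ∀ (msq : ℝ), 0 < msq → msq ≤ m0sq → ∀ (μ : Fin (d + 1)),
      HasMaj (BlockNorm.ofBlocks (unitTorusGeo L K M) (blkFine L K M)) (BlockNorm.ofBlocks (unitTorusGeo L K M) (blkFine L K M))
        (symbOp M (L ^ K) (sD M (L ^ K) μ ((L ^ K : ℕ) : ℝ)) ∘ₗ tensorId (Fin (d + 1)) (kingGOp L a msq K (L ^ K) M))
        (fun y y' => β * Real.exp (-(δ * tdistT M y y'))) := by
  obtain ⟨β, δ, hβ, hδ, H⟩ := hasMaj_kingDOp_coarse (d := d) L hLodd hL ha hm0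
  refine ⟨β, δ, hβ, hδ, fun K hK e M _ hM msq hmsq hcap μ => ?_⟩
  rw [symbOp_sD_comp_tensorId_kingGOp]
  exact hasMaj_tensorId (Fin (d + 1)) (fun y y' => mul_nonneg hβ.le (Real.exp_nonneg _)) (H K hK e M hM msq hmsq hcap 1 μ)

/-- **hG′ — PLAIN LETTER, FINE**: `A₀′⁻¹ ⊗ 1 ≤ β·e^{−δ|y−y′|_T}` between the fine unit blocks `blockOf (L^nL^K) ∘ fst` (Σ-a `hasMaj_kingGOp` fine half ⊗ 1, blocks re-read by
`blockOf_comp_underPtN`). [cite: Balaban1985BackgroundPropagators, Thm 3.1 (3.42) p.397 (first entry); King1986, Thm 3.3 (3.7) p.656] -/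
theorem hasMaj_tensorId_kingGOp_fine (hLodd : Odd L) (hL : 2 ≤ L) {a : ℝ} (ha : 0 < a) {m0sq : ℝ} (hm0 : 0 ≤ m0sq) :
    ∃ β δ : ℝ, 0 < β ∧ 0 < δ ∧ ∀ (K : ℕ), 1 ≤ K → ∀ (n e : ℕ) (M : Fin (d + 1) → ℕ) [∀ μ, NeZero (M μ)], (∀ μ, M μ = 2 * L ^ e) →
      ∀ (msq : ℝ), 0 < msq → msq ≤ m0sq →
      HasMaj (BlockNorm.ofBlocks (unitTorusGeo L K M) (fun i : Tor (fine (L ^ n * L ^ K) M) × Fin (d + 1) => blockOf (L ^ n * L ^ K) M i.1))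
        (BlockNorm.ofBlocks (unitTorusGeo L K M) (fun i : Tor (fine (L ^ n * L ^ K) M) × Fin (d + 1) => blockOf (L ^ n * L ^ K) M i.1))
        (tensorId (Fin (d + 1)) (kingGOp L a msq (K + n) (L ^ n * L ^ K) M)) (fun y y' => β * Real.exp (-(δ * tdistT M y y'))) := by
  obtain ⟨β, δ, hβ, hδ, H⟩ := hasMaj_kingGOp (d := d) L hLodd hL ha hm0
  refine ⟨β, δ, hβ, hδ, fun K hK n e M _ hM msq hmsq hcap => ?_⟩
  have h := (H K hK n e M hM msq hmsq hcap 1).2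
  rw [blockOf_comp_underPtN] at h
  exact hasMaj_tensorId (Fin (d + 1)) (fun y y' => mul_nonneg hβ.le (Real.exp_nonneg _)) h

/-- **hG′D — DERIVED PLAIN LETTER, FINE**: `ρ(N′(s_μ − 1))∘(A₀′⁻¹ ⊗ 1) ≤ β·e^{−δ|y−y′|_T}` (Σ-a `hasMaj_kingDOp` ⊗ 1, §0 dictionary).
[cite: Balaban1985BackgroundPropagators, Thm 3.1 (3.42) p.397 (second entry); Balaban1983RegularityDecay, Theorem (1.10) p.573] -/
theorem hasMaj_sD_tensorId_kingGOp_fine (hLodd : Odd L) (hL : 2 ≤ L) {a : ℝ} (ha : 0 < a) {m0sq : ℝ} (hm0 : 0 ≤ m0sq) :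
    ∃ β δ : ℝ, 0 < β ∧ 0 < δ ∧ ∀ (K : ℕ), 1 ≤ K → ∀ (n e : ℕ) (M : Fin (d + 1) → ℕ) [∀ μ, NeZero (M μ)], (∀ μ, M μ = 2 * L ^ e) →
      ∀ (msq : ℝ), 0 < msq → msq ≤ m0sq → ∀ (μ : Fin (d + 1)),
      HasMaj (BlockNorm.ofBlocks (unitTorusGeo L K M) (fun i : Tor (fine (L ^ n * L ^ K) M) × Fin (d + 1) => blockOf (L ^ n * L ^ K) M i.1))
        (BlockNorm.ofBlocks (unitTorusGeo L K M) (fun i : Tor (fine (L ^ n * L ^ K) M) × Fin (d + 1) => blockOf (L ^ n * L ^ K) M i.1))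
        (symbOp M (L ^ n * L ^ K) (sD M (L ^ n * L ^ K) μ ((L ^ n * L ^ K : ℕ) : ℝ)) ∘ₗ tensorId (Fin (d + 1)) (kingGOp L a msq (K + n) (L ^ n * L ^ K) M))
        (fun y y' => β * Real.exp (-(δ * tdistT M y y'))) := by
  obtain ⟨β, δ, hβ, hδ, H⟩ := hasMaj_kingDOp (d := d) L hLodd hL ha hm0
  refine ⟨β, δ, hβ, hδ, fun K hK n e M _ hM msq hmsq hcap μ => ?_⟩
  have h := H K hK n e M hM msq hmsq hcap 1 μ
  rw [blockOf_comp_underPtN] at h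
  rw [symbOp_sD_comp_tensorId_kingGOp]
  exact hasMaj_tensorId (Fin (d + 1)) (fun y y' => mul_nonneg hβ.le (Real.exp_nonneg _)) h

/-- **hDG — THE η-DEFECT LETTER OF THE PROPAGATORS**: `𝔇_{kingPrV}(A₀′⁻¹ ⊗ 1, A₀⁻¹ ⊗ 1) ≤ m₀·(L^K)^{−γ∕2}·e^{−δ|y−y′|_T}` from King's coarse blocks to the fine unit blocks
(Σ-a `hasMaj_idef_kingGOp` — King's (3.71) summed over (2.17), `n ≥ 1` — ⊗ 1, pairing re-read by `underPtN_eq_kingPr`, §0 `idef_kingPrV_tensorId`).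
[cite: King1986, Prop. 3.8 (3.71) p.664, p.664 (pairing); Balaban1985BackgroundPropagators, Thm 3.1 (3.42) p.397 (first entry, shape)] -/
theorem hasMaj_idef_tensorId_kingGOp (hLodd : Odd L) (hL : 2 ≤ L) {a : ℝ} (ha : 0 < a) {m0sq : ℝ} (hm0 : 0 ≤ m0sq) {γ : ℝ} (hγ0 : 0 ≤ γ) (hγ1 : γ < 1) :
    ∃ m₀ δ : ℝ, 0 < m₀ ∧ 0 < δ ∧ ∀ (K : ℕ), 1 ≤ K → ∀ (n : ℕ), 1 ≤ n → ∀ (e : ℕ) (M : Fin (d + 1) → ℕ) [∀ μ, NeZero (M μ)], (∀ μ, M μ = 2 * L ^ e) →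
      ∀ (msq : ℝ), 0 < msq → msq ≤ m0sq →
      HasMaj (BlockNorm.ofBlocks (unitTorusGeo L K M) (blkFine L K M))
        (BlockNorm.ofBlocks (unitTorusGeo L K M) (fun i : Tor (fine (L ^ n * L ^ K) M) × Fin (d + 1) => blockOf (L ^ n * L ^ K) M i.1))
        (idef (pull (kingPrV L K n M)) (pull (kingPrV L K n M)) (tensorId (Fin (d + 1)) (kingGOp L a msq (K + n) (L ^ n * L ^ K) M))
          (tensorId (Fin (d + 1)) (kingGOp L a msq K (L ^ K) M)))
        (fun y y' => m₀ * ((L : ℝ) ^ K) ^ (-(γ / 2)) * Real.exp (-(δ * tdistT M y y'))) := by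
  obtain ⟨m₀, δ, hm₀, hδ, H⟩ := hasMaj_idef_kingGOp (d := d) L hLodd hL ha hm0 hγ0 hγ1
  refine ⟨m₀, δ, hm₀, hδ, fun K hK n hn e M _ hM msq hmsq hcap => ?_⟩
  have h := H K hK n hn e M hM msq hmsq hcap 1
  rw [blockOf_comp_underPtN, underPtN_eq_kingPr] at h
  rw [idef_kingPrV_tensorId]
  exact hasMaj_tensorId (Fin (d + 1)) (fun y y' => mul_nonneg (mul_nonneg hm₀.le (Real.rpow_nonneg (pow_nonneg (Nat.cast_nonneg _) _) _)) (Real.exp_nonneg _)) h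

/-- **hDD — THE η-DEFECT LETTER OF THE DIFFERENCES**: `𝔇_{kingPrV}(ρ(N′(s_μ−1))(A₀′⁻¹ ⊗ 1), ρ(N(s_μ−1))(A₀⁻¹ ⊗ 1)) ≤ m₀·(L^K)^{−γ∕2}·e^{−δ|y−y′|_T}` (Σ-a `hasMaj_idef_kingDOp` —
King's (3.73) summed — ⊗ 1, §0 dictionary twice). [cite: King1986, Prop. 3.9 (3.73) p.665; Balaban1985BackgroundPropagators, Thm 3.1 (3.42) p.397 (second entry, shape)] -/
theorem hasMaj_idef_sD_tensorId_kingGOp (hLodd : Odd L) (hL : 2 ≤ L) {a : ℝ} (ha : 0 < a) {m0sq : ℝ} (hm0 : 0 ≤ m0sq) {γ : ℝ} (hγ0 : 0 ≤ γ) (hγ1 : γ < 1) :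
    ∃ m₀ δ : ℝ, 0 < m₀ ∧ 0 < δ ∧ ∀ (K : ℕ), 1 ≤ K → ∀ (n : ℕ), 1 ≤ n → ∀ (e : ℕ) (M : Fin (d + 1) → ℕ) [∀ μ, NeZero (M μ)], (∀ μ, M μ = 2 * L ^ e) →
      ∀ (msq : ℝ), 0 < msq → msq ≤ m0sq → ∀ (μ : Fin (d + 1)),
      HasMaj (BlockNorm.ofBlocks (unitTorusGeo L K M) (blkFine L K M))
        (BlockNorm.ofBlocks (unitTorusGeo L K M) (fun i : Tor (fine (L ^ n * L ^ K) M) × Fin (d + 1) => blockOf (L ^ n * L ^ K) M i.1))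
        (idef (pull (kingPrV L K n M)) (pull (kingPrV L K n M))
          (symbOp M (L ^ n * L ^ K) (sD M (L ^ n * L ^ K) μ ((L ^ n * L ^ K : ℕ) : ℝ)) ∘ₗ tensorId (Fin (d + 1)) (kingGOp L a msq (K + n) (L ^ n * L ^ K) M))
          (symbOp M (L ^ K) (sD M (L ^ K) μ ((L ^ K : ℕ) : ℝ)) ∘ₗ tensorId (Fin (d + 1)) (kingGOp L a msq K (L ^ K) M)))
        (fun y y' => m₀ * ((L : ℝ) ^ K) ^ (-(γ / 2)) * Real.exp (-(δ * tdistT M y y'))) := by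
  obtain ⟨m₀, δ, hm₀, hδ, H⟩ := hasMaj_idef_kingDOp (d := d) L hLodd hL ha hm0 hγ0 hγ1
  refine ⟨m₀, δ, hm₀, hδ, fun K hK n hn e M _ hM msq hmsq hcap μ => ?_⟩
  have h := H K hK n hn e M hM msq hmsq hcap 1 μ
  rw [blockOf_comp_underPtN, underPtN_eq_kingPr] at h
  rw [symbOp_sD_comp_tensorId_kingGOp, symbOp_sD_comp_tensorId_kingGOp, idef_kingPrV_tensorId]
  exact hasMaj_tensorId (Fin (d + 1)) (fun y y' => mul_nonneg (mul_nonneg hm₀.le (Real.rpow_nonneg (pow_nonneg (Nat.cast_nonneg _) _) _)) (Real.exp_nonneg _)) h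

/-- **hGc — THE `c′`-DEFECT SANDWICHED UNDER THE FRONT `A₀′⁻¹ ⊗ 1`, NO FIT LETTER** (this seat's M-C ★★★ `hasMaj_comp_idef_mulOp_blockAvg_of_divAdj` at `T′ := A₀′⁻¹ ⊗ 1`, its `d + 1` divergence
rows `(A₀′⁻¹ ⊗ 1)∘ρ(N′(s_κ⁻¹ − 1)) = (A₀′⁻¹N′∇′*_κ) ⊗ 1` supplied by Σ-d `hasMaj_kingSOp_fine`): for every fine multiplier `|c′| ≤ r`,
`(A₀′⁻¹ ⊗ 1)∘𝔇_{kingPrV}(M_{c′}, M_{blockAvg c′}) ≤ β·r·(L^K)⁻¹·e^{−δ|y−y′|_T}` — ONE rate factor, from the sup of `c′` ALONE.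
[cite: Balaban1985BackgroundPropagators, (3.35) p.396 (the letter «|A| ≤ O(1)Mα₀(L^jη)^{−1}»), (3.52) p.400, Thm 3.1 (3.42) p.397 (third entry: the row consumed); King1986, p.664 (pairing)] -/
theorem hasMaj_tensorId_kingGOp_comp_idef_mulOp_blockAvg (hLodd : Odd L) (hL : 2 ≤ L) {a : ℝ} (ha : 0 < a) {m0sq : ℝ} (hm0 : 0 ≤ m0sq) :
    ∃ β δ : ℝ, 0 < β ∧ 0 < δ ∧ ∀ (K : ℕ), 1 ≤ K → ∀ (n e : ℕ) (M : Fin (d + 1) → ℕ) [∀ μ, NeZero (M μ)], (∀ μ, M μ = 2 * L ^ e) →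
      ∀ (msq : ℝ), 0 < msq → msq ≤ m0sq → ∀ (c' : Tor (fine (L ^ n * L ^ K) M) × Fin (d + 1) → ℝ) (r : ℝ), 0 ≤ r → (∀ z, |c' z| ≤ r) →
      HasMaj (BlockNorm.ofBlocks (unitTorusGeo L K M) (blkFine L K M))
        (BlockNorm.ofBlocks (unitTorusGeo L K M) (fun i : Tor (fine (L ^ n * L ^ K) M) × Fin (d + 1) => blockOf (L ^ n * L ^ K) M i.1))
        (tensorId (Fin (d + 1)) (kingGOp L a msq (K + n) (L ^ n * L ^ K) M) ∘ₗ
          idef (pull (kingPrV L K n M)) (pull (kingPrV L K n M)) (mulOp c') (mulOp (blockAvg (kingPrV L K n M) c')))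
        (fun y y' => β * r * (((L ^ K : ℕ) : ℝ))⁻¹ * Real.exp (-(δ * tdistT M y y'))) := by
  obtain ⟨β, δ, hβ, hδ, H⟩ := hasMaj_kingSOp_fine (d := d) L hLodd hL ha hm0
  refine ⟨2 * ((d : ℝ) + 1) * β, δ, by positivity, hδ, fun K hK n e M _ hM msq hmsq hcap c' r hr hc' => ?_⟩
  have hT : ∀ κ : Fin (d + 1), HasMaj (BlockNorm.ofBlocks (unitTorusGeo L K M) (fun i : Tor (fine (L ^ n * L ^ K) M) × Fin (d + 1) => blockOf (L ^ n * L ^ K) M i.1))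
      (BlockNorm.ofBlocks (unitTorusGeo L K M) (fun i : Tor (fine (L ^ n * L ^ K) M) × Fin (d + 1) => blockOf (L ^ n * L ^ K) M i.1))
      (tensorId (Fin (d + 1)) (kingGOp L a msq (K + n) (L ^ n * L ^ K) M) ∘ₗ symbOp M (L ^ n * L ^ K) (((L ^ n * L ^ K : ℕ) : ℝ) • (sTinv M (L ^ n * L ^ K) κ - 1)))
      (fun y y' => β * Real.exp (-(δ * tdistT M y y'))) := fun κ => by
    have h := H K hK n e M hM msq hmsq hcap 1 κ
    rw [blockOf_comp_underPtN] at h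
    rw [tensorId_kingGOp_comp_symbOp_divAdj]
    exact hasMaj_tensorId (Fin (d + 1)) (fun y y' => mul_nonneg hβ.le (Real.exp_nonneg _)) h
  refine (hasMaj_comp_idef_mulOp_blockAvg_of_divAdj M K n (fun y y' => mul_nonneg hβ.le (Real.exp_nonneg _)) hr hc' hT).mono fun y y' => le_of_eq ?_
  push_cast
  ring

/-- **THE U-BLIND THIRD ENTRY `⊗ 1`**: `𝔇_{kingPrV}((A₀′⁻¹N′∇′*_ν) ⊗ 1, (A₀⁻¹N∇*_ν) ⊗ 1) ≤ m₀·(L^K)^{−γ∕2}·e^{−δ|y−y′|_T}` (Σ-a `hasMaj_idef_kingSOp` ⊗ 1; the by-name packaging's entry 2,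
background-blind). [cite: King1986, Prop. 3.9 (3.73) p.665; Balaban1985BackgroundPropagators, Thm 3.1 (3.42) p.397 (third entry, shape)] -/
theorem hasMaj_idef_tensorId_kingSOp (hLodd : Odd L) (hL : 2 ≤ L) {a : ℝ} (ha : 0 < a) {m0sq : ℝ} (hm0 : 0 ≤ m0sq) {γ : ℝ} (hγ0 : 0 ≤ γ) (hγ1 : γ < 1) :
    ∃ m₀ δ : ℝ, 0 < m₀ ∧ 0 < δ ∧ ∀ (K : ℕ), 1 ≤ K → ∀ (n : ℕ), 1 ≤ n → ∀ (e : ℕ) (M : Fin (d + 1) → ℕ) [∀ μ, NeZero (M μ)], (∀ μ, M μ = 2 * L ^ e) →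
      ∀ (msq : ℝ), 0 < msq → msq ≤ m0sq → ∀ (ν : Fin (d + 1)),
      HasMaj (BlockNorm.ofBlocks (unitTorusGeo L K M) (blkFine L K M))
        (BlockNorm.ofBlocks (unitTorusGeo L K M) (fun i : Tor (fine (L ^ n * L ^ K) M) × Fin (d + 1) => blockOf (L ^ n * L ^ K) M i.1))
        (idef (pull (kingPrV L K n M)) (pull (kingPrV L K n M)) (tensorId (Fin (d + 1)) (kingSOp L a msq (K + n) (L ^ n * L ^ K) M ν))
          (tensorId (Fin (d + 1)) (kingSOp L a msq K (L ^ K) M ν)))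
        (fun y y' => m₀ * ((L : ℝ) ^ K) ^ (-(γ / 2)) * Real.exp (-(δ * tdistT M y y'))) := by
  obtain ⟨m₀, δ, hm₀, hδ, H⟩ := hasMaj_idef_kingSOp (d := d) L hLodd hL ha hm0 hγ0 hγ1
  refine ⟨m₀, δ, hm₀, hδ, fun K hK n hn e M _ hM msq hmsq hcap ν => ?_⟩
  have h := H K hK n hn e M hM msq hmsq hcap 1 ν
  rw [blockOf_comp_underPtN, underPtN_eq_kingPr] at h
  rw [idef_kingPrV_tensorId]
  exact hasMaj_tensorId (Fin (d + 1)) (fun y y' => mul_nonneg (mul_nonneg hm₀.le (Real.rpow_nonneg (pow_nonneg (Nat.cast_nonneg _) _) _)) (Real.exp_nonneg _)) h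

/-- **THE U-BLIND FOURTH ENTRY `⊗ 1`**: `𝔇_{kingPrV}((N′²Δ′A₀′⁻¹) ⊗ 1, (N²ΔA₀⁻¹) ⊗ 1) ≤ m₀·(L^K)^{−γ∕2}·e^{−δ|y−y′|_T}` (Σ-a `hasMaj_idef_kingLapOp` ⊗ 1; the by-name packaging's entry 3,
background-blind). [cite: King1986, Prop. 3.9 (3.73) p.665, (4.1)–(4.5) p.670; Balaban1985BackgroundPropagators, Thm 3.1 (3.42) p.397 (fourth entry, shape)] -/
theorem hasMaj_idef_tensorId_kingLapOp (hLodd : Odd L) (hL : 2 ≤ L) {a : ℝ} (ha : 0 < a) {m0sq : ℝ} (hm0 : 0 ≤ m0sq) {γ : ℝ} (hγ0 : 0 ≤ γ) (hγ1 : γ < 1) :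
    ∃ m₀ δ : ℝ, 0 < m₀ ∧ 0 < δ ∧ ∀ (K : ℕ), 1 ≤ K → ∀ (n : ℕ), 1 ≤ n → ∀ (e : ℕ) (M : Fin (d + 1) → ℕ) [∀ μ, NeZero (M μ)], (∀ μ, M μ = 2 * L ^ e) →
      ∀ (msq : ℝ), 0 < msq → msq ≤ m0sq →
      HasMaj (BlockNorm.ofBlocks (unitTorusGeo L K M) (blkFine L K M))
        (BlockNorm.ofBlocks (unitTorusGeo L K M) (fun i : Tor (fine (L ^ n * L ^ K) M) × Fin (d + 1) => blockOf (L ^ n * L ^ K) M i.1))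
        (idef (pull (kingPrV L K n M)) (pull (kingPrV L K n M)) (tensorId (Fin (d + 1)) (kingLapOp L a msq (K + n) (L ^ n * L ^ K) M))
          (tensorId (Fin (d + 1)) (kingLapOp L a msq K (L ^ K) M)))
        (fun y y' => m₀ * ((L : ℝ) ^ K) ^ (-(γ / 2)) * Real.exp (-(δ * tdistT M y y'))) := by
  obtain ⟨m₀, δ, hm₀, hδ, H⟩ := hasMaj_idef_kingLapOp (d := d) L hLodd hL ha hm0 hγ0 hγ1
  refine ⟨m₀, δ, hm₀, hδ, fun K hK n hn e M _ hM msq hmsq hcap => ?_⟩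
  have h := H K hK n hn e M hM msq hmsq hcap 1
  rw [blockOf_comp_underPtN, underPtN_eq_kingPr] at h
  rw [idef_kingPrV_tensorId]
  exact hasMaj_tensorId (Fin (d + 1)) (fun y y' => mul_nonneg (mul_nonneg hm₀.le (Real.rpow_nonneg (pow_nonneg (Nat.cast_nonneg _) _) _)) (Real.exp_nonneg _)) h

end Letters

/-! ## §2 ★ All nine rows at one `(δ, β)` -/

section Uniform

variable {M : Fin (d + 1) → ℕ} [∀ μ, NeZero (M μ)] {K : ℕ}

omit [NeZero L] in
/-- weakening a decaying block majorant: larger constant, slower rate. [folklore] -/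
theorem hasMaj_weaken {F₁ F₂ : Type} [AddCommGroup F₁] [Module ℝ F₁] [AddCommGroup F₂] [Module ℝ F₂] {b₁ : BlockNorm (unitTorusGeo L K M) F₁} {b₂ : BlockNorm (unitTorusGeo L K M) F₂}
    {T : F₁ →ₗ[ℝ] F₂} {A B t δ : ℝ} (hA : 0 ≤ A) (hAB : A ≤ B) (hδt : δ ≤ t)
    (h : HasMaj b₁ b₂ T (fun y y' => A * Real.exp (-(t * tdistT M y y')))) : HasMaj b₁ b₂ T (fun y y' => B * Real.exp (-(δ * tdistT M y y'))) :=
  h.mono fun y y' => mul_le_mul hAB (Real.exp_le_exp.mpr (by nlinarith [tdistT_nonneg M y y'])) (Real.exp_nonneg _) (hA.trans hAB)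

omit [NeZero L] in
/-- weakening a weighted decaying block majorant. [folklore] -/
theorem hasMaj_weaken₂ {F₁ F₂ : Type} [AddCommGroup F₁] [Module ℝ F₁] [AddCommGroup F₂] [Module ℝ F₂] {b₁ : BlockNorm (unitTorusGeo L K M) F₁} {b₂ : BlockNorm (unitTorusGeo L K M) F₂}
    {T : F₁ →ₗ[ℝ] F₂} {A B w t δ : ℝ} (hA : 0 ≤ A) (hAB : A ≤ B) (hw : 0 ≤ w) (hδt : δ ≤ t)
    (h : HasMaj b₁ b₂ T (fun y y' => A * w * Real.exp (-(t * tdistT M y y')))) : HasMaj b₁ b₂ T (fun y y' => B * w * Real.exp (-(δ * tdistT M y y'))) :=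
  h.mono fun y y' => mul_le_mul (mul_le_mul_of_nonneg_right hAB hw) (Real.exp_le_exp.mpr (by nlinarith [tdistT_nonneg M y y'])) (Real.exp_nonneg _)
    (mul_nonneg (hA.trans hAB) hw)

variable (d)

/-- ★ **ALL NINE ROWS III-B CONSUMES, AT ONE `(δ, β)`** — for King's full `A = 0` propagator `⊗ 1` on the 1-form pairing carrier: the four plain rows (`A₀⁻¹ ⊗ 1`, `ρ(N(s_μ−1))(A₀⁻¹ ⊗ 1)`, coarse and
fine), the two η-defect rows (`≤ β(L^K)^{−γ∕2}e^{−δd}`), the `c′`-defect sandwiched under `A₀′⁻¹ ⊗ 1` (`≤ βr(L^K)⁻¹e^{−δd}`, M-C) and under `ρ(N′(s_ν−1))(A₀′⁻¹ ⊗ 1)` (`≤ βr((K+2)∕L^K)e^{−δd}`, dag-n15-d's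
cell-oscillation row), for every `K ≥ 1`, `n ≥ 1`, cube `2L^e`, mass `0 < m² ≤ m₀²`, every direction, every fine multiplier `|c′| ≤ r` — NO letter on `∇c′`, NO fit of `c′`.
[cite: Balaban1985BackgroundPropagators, Thm 3.1 (3.42) p.397 (shape), (3.35) p.396, (3.52) p.400; King1986, (2.13)–(2.17) p.653, Prop. 3.8 (3.71) p.664, Prop. 3.9 (3.73) p.665, (4.42) p.675 (levels)] -/
theorem kingJet_uniform_letters (hd : 1 ≤ d) (hLodd : Odd L) (hL : 2 ≤ L) {a : ℝ} (ha : 0 < a) {m0sq : ℝ} (hm0 : 0 ≤ m0sq) {γ : ℝ} (hγ0 : 0 ≤ γ) (hγ1 : γ < 1) :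
    ∃ δ β : ℝ, 0 < δ ∧ 0 < β ∧ ∀ (K : ℕ), 1 ≤ K → ∀ (n : ℕ), 1 ≤ n → ∀ (e : ℕ) (M : Fin (d + 1) → ℕ) [∀ μ, NeZero (M μ)], (∀ μ, M μ = 2 * L ^ e) →
      ∀ (msq : ℝ), 0 < msq → msq ≤ m0sq →
      HasMaj (BlockNorm.ofBlocks (unitTorusGeo L K M) (blkFine L K M)) (BlockNorm.ofBlocks (unitTorusGeo L K M) (blkFine L K M))
          (tensorId (Fin (d + 1)) (kingGOp L a msq K (L ^ K) M)) (fun y y' => β * Real.exp (-(δ * tdistT M y y'))) ∧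
      (∀ μ, HasMaj (BlockNorm.ofBlocks (unitTorusGeo L K M) (blkFine L K M)) (BlockNorm.ofBlocks (unitTorusGeo L K M) (blkFine L K M))
          (symbOp M (L ^ K) (sD M (L ^ K) μ ((L ^ K : ℕ) : ℝ)) ∘ₗ tensorId (Fin (d + 1)) (kingGOp L a msq K (L ^ K) M)) (fun y y' => β * Real.exp (-(δ * tdistT M y y')))) ∧
      HasMaj (BlockNorm.ofBlocks (unitTorusGeo L K M) (fun i : Tor (fine (L ^ n * L ^ K) M) × Fin (d + 1) => blockOf (L ^ n * L ^ K) M i.1))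
          (BlockNorm.ofBlocks (unitTorusGeo L K M) (fun i : Tor (fine (L ^ n * L ^ K) M) × Fin (d + 1) => blockOf (L ^ n * L ^ K) M i.1))
          (tensorId (Fin (d + 1)) (kingGOp L a msq (K + n) (L ^ n * L ^ K) M)) (fun y y' => β * Real.exp (-(δ * tdistT M y y'))) ∧
      (∀ μ, HasMaj (BlockNorm.ofBlocks (unitTorusGeo L K M) (fun i : Tor (fine (L ^ n * L ^ K) M) × Fin (d + 1) => blockOf (L ^ n * L ^ K) M i.1))
          (BlockNorm.ofBlocks (unitTorusGeo L K M) (fun i : Tor (fine (L ^ n * L ^ K) M) × Fin (d + 1) => blockOf (L ^ n * L ^ K) M i.1))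
          (symbOp M (L ^ n * L ^ K) (sD M (L ^ n * L ^ K) μ ((L ^ n * L ^ K : ℕ) : ℝ)) ∘ₗ tensorId (Fin (d + 1)) (kingGOp L a msq (K + n) (L ^ n * L ^ K) M))
          (fun y y' => β * Real.exp (-(δ * tdistT M y y')))) ∧
      HasMaj (BlockNorm.ofBlocks (unitTorusGeo L K M) (blkFine L K M))
          (BlockNorm.ofBlocks (unitTorusGeo L K M) (fun i : Tor (fine (L ^ n * L ^ K) M) × Fin (d + 1) => blockOf (L ^ n * L ^ K) M i.1))
          (idef (pull (kingPrV L K n M)) (pull (kingPrV L K n M)) (tensorId (Fin (d + 1)) (kingGOp L a msq (K + n) (L ^ n * L ^ K) M))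
            (tensorId (Fin (d + 1)) (kingGOp L a msq K (L ^ K) M)))
          (fun y y' => β * ((L : ℝ) ^ K) ^ (-(γ / 2)) * Real.exp (-(δ * tdistT M y y'))) ∧
      (∀ μ, HasMaj (BlockNorm.ofBlocks (unitTorusGeo L K M) (blkFine L K M))
          (BlockNorm.ofBlocks (unitTorusGeo L K M) (fun i : Tor (fine (L ^ n * L ^ K) M) × Fin (d + 1) => blockOf (L ^ n * L ^ K) M i.1))
          (idef (pull (kingPrV L K n M)) (pull (kingPrV L K n M))
            (symbOp M (L ^ n * L ^ K) (sD M (L ^ n * L ^ K) μ ((L ^ n * L ^ K : ℕ) : ℝ)) ∘ₗ tensorId (Fin (d + 1)) (kingGOp L a msq (K + n) (L ^ n * L ^ K) M))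
            (symbOp M (L ^ K) (sD M (L ^ K) μ ((L ^ K : ℕ) : ℝ)) ∘ₗ tensorId (Fin (d + 1)) (kingGOp L a msq K (L ^ K) M)))
          (fun y y' => β * ((L : ℝ) ^ K) ^ (-(γ / 2)) * Real.exp (-(δ * tdistT M y y')))) ∧
      (∀ (c' : Tor (fine (L ^ n * L ^ K) M) × Fin (d + 1) → ℝ) (r : ℝ), 0 ≤ r → (∀ z, |c' z| ≤ r) →
        HasMaj (BlockNorm.ofBlocks (unitTorusGeo L K M) (blkFine L K M))
            (BlockNorm.ofBlocks (unitTorusGeo L K M) (fun i : Tor (fine (L ^ n * L ^ K) M) × Fin (d + 1) => blockOf (L ^ n * L ^ K) M i.1))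
            (tensorId (Fin (d + 1)) (kingGOp L a msq (K + n) (L ^ n * L ^ K) M) ∘ₗ
              idef (pull (kingPrV L K n M)) (pull (kingPrV L K n M)) (mulOp c') (mulOp (blockAvg (kingPrV L K n M) c')))
            (fun y y' => β * r * (((L ^ K : ℕ) : ℝ))⁻¹ * Real.exp (-(δ * tdistT M y y'))) ∧
        ∀ ν, HasMaj (BlockNorm.ofBlocks (unitTorusGeo L K M) (blkFine L K M))
            (BlockNorm.ofBlocks (unitTorusGeo L K M) (fun i : Tor (fine (L ^ n * L ^ K) M) × Fin (d + 1) => blockOf (L ^ n * L ^ K) M i.1))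
            ((symbOp M (L ^ n * L ^ K) (sD M (L ^ n * L ^ K) ν ((L ^ n * L ^ K : ℕ) : ℝ)) ∘ₗ tensorId (Fin (d + 1)) (kingGOp L a msq (K + n) (L ^ n * L ^ K) M)) ∘ₗ
              idef (pull (kingPrV L K n M)) (pull (kingPrV L K n M)) (mulOp c') (mulOp (blockAvg (kingPrV L K n M) c')))
            (fun y y' => β * r * ((((K : ℕ) : ℝ) + 2) / (L : ℝ) ^ K) * Real.exp (-(δ * tdistT M y y')))) := by
  obtain ⟨β₁, δ₁, hβ₁, hδ₁, H₁⟩ := hasMaj_tensorId_kingGOp_coarse (d := d) L hLodd hL ha hm0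
  obtain ⟨β₂, δ₂, hβ₂, hδ₂, H₂⟩ := hasMaj_sD_tensorId_kingGOp_coarse (d := d) L hLodd hL ha hm0
  obtain ⟨β₃, δ₃, hβ₃, hδ₃, H₃⟩ := hasMaj_tensorId_kingGOp_fine (d := d) L hLodd hL ha hm0
  obtain ⟨β₄, δ₄, hβ₄, hδ₄, H₄⟩ := hasMaj_sD_tensorId_kingGOp_fine (d := d) L hLodd hL ha hm0
  obtain ⟨β₅, δ₅, hβ₅, hδ₅, H₅⟩ := hasMaj_idef_tensorId_kingGOp (d := d) L hLodd hL ha hm0 hγ0 hγ1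
  obtain ⟨β₆, δ₆, hβ₆, hδ₆, H₆⟩ := hasMaj_idef_sD_tensorId_kingGOp (d := d) L hLodd hL ha hm0 hγ0 hγ1
  obtain ⟨β₇, δ₇, hβ₇, hδ₇, H₇⟩ := hasMaj_tensorId_kingGOp_comp_idef_mulOp_blockAvg (d := d) L hLodd hL ha hm0
  obtain ⟨β₈, δ₈, hβ₈, hδ₈, H₈⟩ := hasMaj_kingDOp_comp_idef_mulOp_blockAvg (d := d) L hd hLodd hL ha hm0
  -- one rate, one constant
  set δ : ℝ := min (min (min δ₁ δ₂) (min δ₃ δ₄)) (min (min δ₅ δ₆) (min δ₇ δ₈)) with hδ_def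
  set β : ℝ := β₁ + β₂ + β₃ + β₄ + β₅ + β₆ + β₇ + β₈ with hβ_def
  have hδ : 0 < δ := lt_min (lt_min (lt_min hδ₁ hδ₂) (lt_min hδ₃ hδ₄)) (lt_min (lt_min hδ₅ hδ₆) (lt_min hδ₇ hδ₈))
  have hβ : 0 < β := by positivity
  have e₁ : δ ≤ δ₁ := (min_le_left _ _).trans ((min_le_left _ _).trans (min_le_left _ _))
  have e₂ : δ ≤ δ₂ := (min_le_left _ _).trans ((min_le_left _ _).trans (min_le_right _ _))
  have e₃ : δ ≤ δ₃ := (min_le_left _ _).trans ((min_le_right _ _).trans (min_le_left _ _))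
  have e₄ : δ ≤ δ₄ := (min_le_left _ _).trans ((min_le_right _ _).trans (min_le_right _ _))
  have e₅ : δ ≤ δ₅ := (min_le_right _ _).trans ((min_le_left _ _).trans (min_le_left _ _))
  have e₆ : δ ≤ δ₆ := (min_le_right _ _).trans ((min_le_left _ _).trans (min_le_right _ _))
  have e₇ : δ ≤ δ₇ := (min_le_right _ _).trans ((min_le_right _ _).trans (min_le_left _ _))
  have e₈ : δ ≤ δ₈ := (min_le_right _ _).trans ((min_le_right _ _).trans (min_le_right _ _))
  have b₁ : β₁ ≤ β := by rw [hβ_def]; linarith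
  have b₂ : β₂ ≤ β := by rw [hβ_def]; linarith
  have b₃ : β₃ ≤ β := by rw [hβ_def]; linarith
  have b₄ : β₄ ≤ β := by rw [hβ_def]; linarith
  have b₅ : β₅ ≤ β := by rw [hβ_def]; linarith
  have b₆ : β₆ ≤ β := by rw [hβ_def]; linarith
  have b₇ : β₇ ≤ β := by rw [hβ_def]; linarith
  have b₈ : β₈ ≤ β := by rw [hβ_def]; linarith
  refine ⟨δ, β, hδ, hβ, fun K hK n hn e M _ hM msq hmsq hcap => ⟨?_, fun μ => ?_, ?_, fun μ => ?_, ?_, fun μ => ?_, fun c' r hr hc' => ⟨?_, fun ν => ?_⟩⟩⟩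
  · exact hasMaj_weaken L hβ₁.le b₁ e₁ (H₁ K hK e M hM msq hmsq hcap)
  · exact hasMaj_weaken L hβ₂.le b₂ e₂ (H₂ K hK e M hM msq hmsq hcap μ)
  · exact hasMaj_weaken L hβ₃.le b₃ e₃ (H₃ K hK n e M hM msq hmsq hcap)
  · exact hasMaj_weaken L hβ₄.le b₄ e₄ (H₄ K hK n e M hM msq hmsq hcap μ)
  · exact hasMaj_weaken₂ L hβ₅.le b₅ (Real.rpow_nonneg (pow_nonneg (Nat.cast_nonneg _) _) _) e₅ (H₅ K hK n hn e M hM msq hmsq hcap)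
  · exact hasMaj_weaken₂ L hβ₆.le b₆ (Real.rpow_nonneg (pow_nonneg (Nat.cast_nonneg _) _) _) e₆ (H₆ K hK n hn e M hM msq hmsq hcap μ)
  · have h := H₇ K hK n e M hM msq hmsq hcap c' r hr hc'
    have hw : 0 ≤ r * (((L ^ K : ℕ) : ℝ))⁻¹ := mul_nonneg hr (inv_nonneg.mpr (Nat.cast_nonneg _))
    have h' := hasMaj_weaken₂ L (w := r * (((L ^ K : ℕ) : ℝ))⁻¹) hβ₇.le b₇ hw e₇ (h.mono fun y y' => le_of_eq (by ring))
    exact h'.mono fun y y' => le_of_eq (by ring)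
  · have h := H₈ K hK n e M hM msq hmsq hcap ν c' r hr hc'
    have hw : 0 ≤ r * ((((K : ℕ) : ℝ) + 2) / (L : ℝ) ^ K) := mul_nonneg hr (div_nonneg (by positivity) (pow_nonneg (Nat.cast_nonneg _) _))
    have h' := hasMaj_weaken₂ L (w := r * ((((K : ℕ) : ℝ) + 2) / (L : ℝ) ^ K)) hβ₈.le b₈ hw e₈ (h.mono fun y y' => le_of_eq (by ring))
    exact h'.mono fun y y' => le_of_eq (by ring)

end Uniform

end Summit.QuantumFields.YangMills.BalabanUVNodes.N15.TwoGrid.KingJet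

end
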